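import Summits.QuantumFields.Balaban3D.Proofs.LogZLocalizedWitness
import Literature.MathematicalPhysics.QuantumFieldTheory.Balaban1985CMP102.BindersNewborn

/-!
# Non-vacuity witness for the GAP binder G3D-08 `BindersNewborn.NewbornTerms45AsCited` (prover seat p6, lane
# `pub-balaban3d`, ruling R-46N′) — the (61)-born input of `…Proofs.Newborn46.newborn46_series`

[folklore] consistency check, nothing about gauge theory: over the G3D-07 witness `LogZLocalizedWitness.trivLocalizedAsCited`
(trivial run, one-block 3-torus carrier, pieces `Ψ ≡ 0`, far terms `0`) the binder holds with `C45 = 0` — the jet of the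
zero piece vanishes.  So the hypothesis bundle {G3D-07, G3D-08} of the newborn slice is jointly satisfiable.
-/

noncomputable section

open Metric Set Finset
open Literature.MathematicalPhysics.QuantumFieldTheory.Balaban1983to89
open Literature.MathematicalPhysics.QuantumFieldTheory.Balaban1983to89.B10
open Literature.MathematicalPhysics.QuantumFieldTheory.Balaban1983to89.B10Assembly
open Literature.MathematicalPhysics.QuantumFieldTheory.Balaban1983to89.TreeLengthTorus (tsys tcubeSys TPt)
open Literature.MathematicalPhysics.QuantumFieldTheory.Balaban1985CMP102.BindersNewborn (NewbornTerms45AsCited)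
open Summit.QuantumFields.Balaban3D.Proofs.LogZLocalizedWitness

namespace Summit.QuantumFields.Balaban3D.Proofs.NewbornWitness

open scoped Nat

/-- **G3D-08 `BindersNewborn.NewbornTerms45AsCited` is inhabited** over the G3D-07 witness `trivLocalizedAsCited` with
`C45 = 0`: the jet of the zero piece vanishes. [folklore] -/
theorem trivNewborn45 (K k : ℕ) (κ : ℝ) :
    NewbornTerms45AsCited (trivRun K) k (S := tsys 3 1) ℂ (fun _ : Unit => ContinuousLinearMap.id ℂ ℂ) 1 1 0 0 κ
      (trivPieces K k).logZU (trivPieces K k).logZ1 (fun _ _ _ => (0 : ℂ)) (fun _ => Finset.univ)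
      (trivLocalizedAsCited K k κ) 0 where
  C45_nonneg := le_rfl
  jet45 := fun X h U => by simp [trivLocalizedAsCited]

end Summit.QuantumFields.Balaban3D.Proofs.NewbornWitness

end
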